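import Mathlib.Analysis.MeanInequalities
import Literature.Analysis.FunctionSpaces.TorusAgmonExplicit
import Literature.Analysis.FunctionSpaces.TorusSobolevNormHolderProofs
import Literature.Analysis.FunctionSpaces.HolderNormTorusProofs
import HarnessLib

/-!
# The sharp Hölder embedding `Ḣ²(T³) ⊂ C^{0,1/2}(T³)` with an explicit constant

Analysis/FunctionSpaces support file (everything proved; no definitions, no named facts). For a
smooth real vector field `v : T³ → ℝ³` on the unit torus `T³ = (ℝ/ℤ)³` we prove the
**Sobolev–Hölder (Morrey) embedding at the critical half-integer order** with an explicit constant,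

  `‖v(x) − v(y)‖² ≤ (4√3/π²) · ‖Δv‖₂² · dist(x, y)`   for all `x, y ∈ T³`

(`Torus.norm_sub_sq_le_laplacian_sq_mul_dist`), i.e. `v` is `½`-Hölder with constant
`(2·3^{1/4}/π) ‖Δv‖₂ ≤ ‖Δv‖₂` (`Torus.norm_sub_le_sqrt_laplacian_sq_mul_sqrt_dist`,
`Torus.holderWith_half_sqrt_laplacian_sq`), and so is its `ℤ³`-periodic lift to `ℝ³`
(`Torus.holderWith_half_lift_sqrt_laplacian_sq`). This is the periodic form of
Bahouri–Chemin–Danchin 2011, Thm. 1.50 (`Ḣ^s(ℝ^d) ⊂ Ċ^{k,ρ}` for `s − d/2 = k + ρ`, `ρ ∈ (0,1)`;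
here `d = 3`, `s = 2`, `(k, ρ) = (0, ½)`), at the SHARP exponent `½`: the tree's
`Torus.MemSobolev.memHolder_of_lt_holds` (`TorusSobolevNormHolderProofs`) gives every `α < ½` with
an inexplicit constant, which is not enough for the Beale–Kato–Majda logarithmic estimate on `T³`
(`FluidPDE/TorusBKMGradientLogBound`), whose logarithm must sit at the `H³` level of the velocity,
i.e. the `H²` level of the vorticity.

Proof (BCD's Fourier-inversion argument, with the frequency optimisation done by an explicit
lattice sum): Fourier inversion for the smooth field gives
`‖v(x) − v(y)‖ ≤ ∑_k ‖e_k(x) − e_k(y)‖ ‖v̂(k)‖` (`Torus.norm_sub_le_tsum_norm_mFourier_sub_mul`); the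
chord estimate `‖e_k(x) − e_k(y)‖ ≤ min(2, 2π|k|₁ dist(x,y))` (tree,
`Torus.norm_mFourier_sub_mFourier_le`) gives `‖e_k(x) − e_k(y)‖² ≤ min(4, 3μₖt²)`, `μₖ = 4π²|k|²`,
`t = dist(x,y)`; Cauchy–Schwarz with the weights `μₖ²` (Parseval for `Δv`,
`Torus.hasSum_freq_sq_mul_norm_sq_mFourierCoeff`) reduces the claim to a bound
`∑_{k≠0} ‖e_k(x) − e_k(y)‖²/μₖ² ≤ K ∑_{k≠0} ρ/(μₖ(μₖ+ρ)) ≤ K ρ^{1/2}/π²` by the EXPLICIT Agmon lattice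
sum of the tree (`Torus.tsum_agmonWeight_le_sqrt_div_pi_sq`, `ρ ≥ 4π²`)
(`Torus.norm_sub_sq_le_of_chord_weight_bound`), used with `(ρ, K) = (4/(3t²), 6t²)` when
`t ≤ 1/(π√3)` (since `min(4, 3μt²) ≤ 24μt²/(4 + 3μt²)`) and with `(ρ, K) = (4π², 2/π²)` otherwise;
both give `(4√3/π²) t`.

* `Torus.norm_sub_le_tsum_norm_mFourier_sub_mul` — modulus of continuity by the coefficients;
* (private) `Torus.norm_mFourier_sub_mFourier_sq_le` — `‖e_k(x) − e_k(y)‖² ≤ card d · 4π²|k|² · dist(x,y)²`;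
* `Torus.norm_sub_sq_le_of_chord_weight_bound` — the Cauchy–Schwarz step with a free `ρ ≥ 4π²`;
* `Torus.norm_sub_sq_le_laplacian_sq_mul_dist` — the main estimate, constant `4√3/π² ≈ 0.702`;
* `Torus.norm_sub_le_sqrt_laplacian_sq_mul_sqrt_dist`, `Torus.holderWith_half_sqrt_laplacian_sq`,
  `Torus.holderWith_half_lift_sqrt_laplacian_sq` — square-root / `HolderWith` forms (constant
  rounded up to `‖Δv‖₂`), on `T³` and for the lift `v ∘ proj` on `ℝ³`.

## Mathlib / tree search

Mathlib: `Real.inner_le_Lp_mul_Lq_tsum_of_nonneg`, `norm_tsum_le_tsum_norm`,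
`Finset.sum_mul_sq_le_sq_mul_sq`, `UnitAddTorus.mFourier_zero`. Tree (all used):
`Torus.IsSmooth.fourierSynth_mFourierCoeff`, `Torus.RapidDecay.hasSum_fourierSynth`,
`Torus.IsSmooth.rapidDecay_mFourierCoeff` (`TorusFourierSynthesis`);
`Torus.hasSum_freq_sq_mul_norm_sq_mFourierCoeff` (`TorusAgmonExplicit`);
`Torus.norm_mFourier_sub_mFourier_le`, `Torus.norm_mFourier_sub_mFourier_le_two`
(`TorusSobolevNormHolderProofs`); `Torus.summable_agmonWeight`,
`Torus.tsum_agmonWeight_le_sqrt_div_pi_sq` (`TorusAgmonLatticeSum(Explicit)`);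
`FunctionSpaces.holderWith_of_dist_le` (`HolderAlgebra`); `Torus.HolderWith.lift`
(`HolderNormTorusProofs`). Existing Hölder embeddings on the torus
(`Torus.MemSobolev.memHolder_of_lt_holds`) are non-sharp (`α < s − d/2`) with inexplicit constants
(searched `HolderWith`, `memHolder` under `FunctionSpaces/Torus*`).

## References

* H. Bahouri, J.-Y. Chemin, R. Danchin, *Fourier Analysis and Nonlinear Partial Differential
  Equations*, Grundlehren 343 (Springer 2011), Thm. 1.50 (book p. 37) and its proof.
  [BahouriCheminDanchinGL343]
* L. Grafakos, *Classical Fourier Analysis*, 3rd ed., GTM 249 (Springer 2014), Prop. 3.2.5,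
  Prop. 3.2.7 (3). [Grafakos2014]
* P. Constantin, C. Foias, *Navier–Stokes Equations*, Univ. Chicago Press 1988, Ch. 4 (Agmon-type
  lattice sums). [ConstantinFoias1988]
-/

noncomputable section

open MeasureTheory Set Filter Topology Real UnitAddTorus
open scoped ENNReal NNReal

namespace Literature.Analysis.FunctionSpaces

namespace Torus

variable {d : Type*} [Fintype d] [DecidableEq d]

/-! ### The modulus of continuity by the Fourier coefficients -/

/-- Fourier inversion bounds the modulus of continuity by the coefficients:
`‖v(x) − v(y)‖ ≤ ∑_k ‖e_k(x) − e_k(y)‖ ‖𝓕(complexify ∘ v)(k)‖` for smooth `v` (Fourier inversion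
for absolutely summable coefficients, Grafakos 2014, Prop. 3.2.5, applied at `x` and at `y`).
[cite: Grafakos2014, Prop. 3.2.5] -/
theorem norm_sub_le_tsum_norm_mFourier_sub_mul {v : UnitAddTorus d → EuclideanSpace ℝ d}
    (hv : IsSmooth v) (x y : UnitAddTorus d) :
    ‖v x - v y‖ ≤ ∑' k : d → ℤ, ‖mFourier k x - mFourier k y‖ *
      ‖mFourierCoeff (EuclideanSpace.complexify ∘ v) k‖ := by
  set w : UnitAddTorus d → EuclideanSpace ℂ d := EuclideanSpace.complexify ∘ v with hw_def
  have hw : IsSmooth w := hv.complexify_comp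
  have hc := hw.rapidDecay_mFourierCoeff
  have hsum : ∀ z, HasSum (fun k => mFourier k z • mFourierCoeff w k) (w z) := fun z => by
    have := hc.hasSum_fourierSynth z
    rwa [hw.fourierSynth_mFourierCoeff] at this
  have hdiff : HasSum (fun k => (mFourier k x - mFourier k y) • mFourierCoeff w k) (w x - w y) := by
    have := (hsum x).sub (hsum y)
    simpa only [sub_smul] using this
  have hsn : Summable fun k => ‖(mFourier k x - mFourier k y) • mFourierCoeff w k‖ := by
    refine Summable.of_nonneg_of_le (fun k => norm_nonneg _) (fun k => ?_) (hc.summable_norm.mul_left 2)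
    rw [norm_smul]
    exact mul_le_mul_of_nonneg_right (norm_mFourier_sub_mFourier_le_two k x y) (norm_nonneg _)
  have hwxy : w x - w y = EuclideanSpace.complexify (v x - v y) := by
    simp [hw_def, map_sub]
  calc ‖v x - v y‖ = ‖w x - w y‖ := by rw [hwxy, EuclideanSpace.norm_complexify]
    _ = ‖∑' k, (mFourier k x - mFourier k y) • mFourierCoeff w k‖ := by rw [hdiff.tsum_eq]
    _ ≤ ∑' k, ‖(mFourier k x - mFourier k y) • mFourierCoeff w k‖ := norm_tsum_le_tsum_norm hsn
    _ = ∑' k, ‖mFourier k x - mFourier k y‖ * ‖mFourierCoeff w k‖ :=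
        tsum_congr fun k => norm_smul _ _

omit [DecidableEq d] in
/-- **Chord estimate, squared**: `‖e_k(x) − e_k(y)‖² ≤ card d · 4π²|k|² · dist(x,y)²`
(the tree's `‖e_k(x) − e_k(y)‖ ≤ 2π|k|₁ dist(x,y)` and `|k|₁² ≤ d |k|²`). [folklore] -/
private theorem norm_mFourier_sub_mFourier_sq_le (k : d → ℤ) (x y : UnitAddTorus d) :
    ‖mFourier k x - mFourier k y‖ ^ 2 ≤
      Fintype.card d * (4 * π ^ 2 * freqNormSq k) * dist x y ^ 2 := by
  have h := norm_mFourier_sub_mFourier_le k x y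
  have h0 : 0 ≤ ‖mFourier k x - mFourier k y‖ := norm_nonneg _
  have hCS : (∑ i, |(k i : ℝ)|) ^ 2 ≤ Fintype.card d * freqNormSq k := by
    have := Finset.sum_mul_sq_le_sq_mul_sq Finset.univ (fun _ : d => (1 : ℝ)) (fun i => |(k i : ℝ)|)
    simp only [one_mul, one_pow, Finset.sum_const, Finset.card_univ, nsmul_eq_mul, mul_one,
      sq_abs] at this
    rw [freqNormSq]
    exact this
  calc ‖mFourier k x - mFourier k y‖ ^ 2 ≤ (2 * π * (∑ i, |(k i : ℝ)|) * dist x y) ^ 2 :=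
        pow_le_pow_left₀ h0 h 2
    _ = 4 * π ^ 2 * (∑ i, |(k i : ℝ)|) ^ 2 * dist x y ^ 2 := by ring
    _ ≤ 4 * π ^ 2 * (Fintype.card d * freqNormSq k) * dist x y ^ 2 := by gcongr
    _ = Fintype.card d * (4 * π ^ 2 * freqNormSq k) * dist x y ^ 2 := by ring

omit [DecidableEq d] in
/-- `‖e_k(x) − e_k(y)‖² ≤ 4`. [folklore] -/
private theorem norm_mFourier_sub_mFourier_sq_le_four (k : d → ℤ) (x y : UnitAddTorus d) :
    ‖mFourier k x - mFourier k y‖ ^ 2 ≤ 4 := by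
  have h := norm_mFourier_sub_mFourier_le_two k x y
  have h0 : 0 ≤ ‖mFourier k x - mFourier k y‖ := norm_nonneg _
  nlinarith

omit [DecidableEq d] in
/-- The zero mode does not contribute to differences: `e_0(x) − e_0(y) = 0`. [folklore] -/
private theorem mFourier_zero_sub_mFourier_zero (x y : UnitAddTorus d) :
    mFourier (0 : d → ℤ) x - mFourier (0 : d → ℤ) y = 0 := by
  rw [mFourier_zero]
  simp

/-! ### The Cauchy–Schwarz step with a free Agmon parameter -/

/-- **Weighted Cauchy–Schwarz.** For a smooth real vector field `v` on `T^d`, `card d = 3`, two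
points `x, y`, a parameter `ρ ≥ 4π²` and a constant `K ≥ 0` such that every non-zero mode obeys
`‖e_k(x) − e_k(y)‖² ≤ K ρ μₖ/(μₖ + ρ)`, `μₖ = 4π²|k|²`, one has
`‖v(x) − v(y)‖² ≤ ‖Δv‖₂² · K · ρ^{1/2}/π²`
(`(∑_{k≠0} ‖e_k(x)−e_k(y)‖ ‖v̂ₖ‖)² ≤ ∑ μₖ²‖v̂ₖ‖² · ∑_{k≠0} ‖e_k(x)−e_k(y)‖²/μₖ²`, Parseval for `Δv`, and
the explicit lattice sum `Torus.tsum_agmonWeight_le_sqrt_div_pi_sq`). [cite: ConstantinFoias1988, Ch. 4] -/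
theorem norm_sub_sq_le_of_chord_weight_bound (hd : Fintype.card d = 3)
    {v : UnitAddTorus d → EuclideanSpace ℝ d} (hv : IsSmooth v) (x y : UnitAddTorus d)
    {ρ K : ℝ} (hρ : 4 * π ^ 2 ≤ ρ) (hK : 0 ≤ K)
    (hmode : ∀ k : d → ℤ, k ≠ 0 → ‖mFourier k x - mFourier k y‖ ^ 2 ≤
      K * (ρ * (4 * π ^ 2 * freqNormSq k) / (4 * π ^ 2 * freqNormSq k + ρ))) :
    ‖v x - v y‖ ^ 2 ≤ (∫ z, ‖laplacian v z‖ ^ 2) * (K * (Real.sqrt ρ / π ^ 2)) := by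
  classical
  haveI : Nonempty d := by
    rw [← Fintype.card_pos_iff, hd]; norm_num
  have hπ : 0 < π := Real.pi_pos
  have hρ0 : 0 < ρ := lt_of_lt_of_le (by positivity) hρ
  set c : (d → ℤ) → EuclideanSpace ℂ d := fun k => mFourierCoeff (EuclideanSpace.complexify ∘ v) k
    with hc_def
  set μ : (d → ℤ) → ℝ := fun k => 4 * π ^ 2 * freqNormSq k with hμ_def
  have hμ0 : ∀ k, 0 ≤ μ k := fun k => by
    have := freqNormSq_nonneg k; simp only [hμ_def]; positivity
  have hμpos : ∀ {k : d → ℤ}, k ≠ 0 → 0 < μ k := fun hk => by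
    have := one_le_freqNormSq_of_ne_zero hk; simp only [hμ_def]; positivity
  set ch : (d → ℤ) → ℝ := fun k => ‖mFourier k x - mFourier k y‖ with hch_def
  have hch0 : ∀ k, 0 ≤ ch k := fun k => norm_nonneg _
  have hch_zero : ch 0 = 0 := by
    simp only [hch_def, mFourier_zero_sub_mFourier_zero, norm_zero]
  -- Parseval for `Δv`
  have hB := hasSum_freq_sq_mul_norm_sq_mFourierCoeff hv
  set B2 : ℝ := ∫ z, ‖laplacian v z‖ ^ 2 with hB2
  -- Cauchy–Schwarz factors
  set f : (d → ℤ) → ℝ := fun k => μ k * ‖c k‖ with hf_def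
  set g : (d → ℤ) → ℝ := fun k => if k = 0 then 0 else ch k / μ k with hg_def
  have hf0 : ∀ k, 0 ≤ f k := fun k => by simp only [hf_def]; exact mul_nonneg (hμ0 k) (norm_nonneg _)
  have hg0 : ∀ k, 0 ≤ g k := fun k => by
    simp only [hg_def]; split_ifs
    · exact le_rfl
    · exact div_nonneg (hch0 k) (hμ0 k)
  -- `f k * g k = ch k * ‖c k‖`
  have hfg : ∀ k, f k * g k = ch k * ‖c k‖ := by
    intro k
    by_cases hk : k = 0
    · simp [hf_def, hg_def, hk, hch_zero]
    · have hm : 0 < μ k := hμpos hk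
      simp only [hf_def, hg_def, if_neg hk]
      field_simp
  -- `∑ f k ^ 2 = ‖Δv‖₂²`
  have hf2 : HasSum (fun k => f k ^ (2 : ℝ)) B2 := by
    refine hB.congr_fun fun k => ?_
    simp only [hf_def, Real.rpow_two]
    rw [mul_pow]
  -- `g k ^ 2 ≤ K · (Agmon weight)`
  have hg2le_pt : ∀ k, g k ^ (2 : ℝ) ≤ K * (if k = 0 then (0 : ℝ) else
      ρ / (4 * π ^ 2 * freqNormSq k * (4 * π ^ 2 * freqNormSq k + ρ))) := by
    intro k
    rw [Real.rpow_two]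
    by_cases hk : k = 0
    · simp [hg_def, hk]
    · simp only [hg_def, if_neg hk]
      have hm : 0 < μ k := hμpos hk
      have hmode' : ch k ^ 2 ≤ K * (ρ * μ k / (μ k + ρ)) := hmode k hk
      rw [div_pow]
      rw [div_le_iff₀ (pow_pos hm 2)]
      calc ch k ^ 2 ≤ K * (ρ * μ k / (μ k + ρ)) := hmode'
        _ = K * (ρ / (4 * π ^ 2 * freqNormSq k * (4 * π ^ 2 * freqNormSq k + ρ))) * μ k ^ 2 := by
            simp only [hμ_def]
            have hden : 0 < 4 * π ^ 2 * freqNormSq k + ρ := by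
              have := hμ0 k; simp only [hμ_def] at this; linarith
            field_simp
  have hg2nn : ∀ k, 0 ≤ g k ^ (2 : ℝ) := fun k => by rw [Real.rpow_two]; positivity
  have hg2s : Summable fun k => g k ^ (2 : ℝ) :=
    Summable.of_nonneg_of_le hg2nn hg2le_pt ((summable_agmonWeight hd.le hρ0).mul_left K)
  have hg2le : ∑' k, g k ^ (2 : ℝ) ≤ K * (Real.sqrt ρ / π ^ 2) := by
    calc ∑' k, g k ^ (2 : ℝ) ≤ ∑' k, K * (if k = 0 then (0 : ℝ) else
          ρ / (4 * π ^ 2 * freqNormSq k * (4 * π ^ 2 * freqNormSq k + ρ))) :=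
          Summable.tsum_le_tsum hg2le_pt hg2s ((summable_agmonWeight hd.le hρ0).mul_left K)
      _ = K * ∑' k, (if k = 0 then (0 : ℝ) else
          ρ / (4 * π ^ 2 * freqNormSq k * (4 * π ^ 2 * freqNormSq k + ρ))) := tsum_mul_left
      _ ≤ K * (Real.sqrt ρ / π ^ 2) :=
          mul_le_mul_of_nonneg_left (tsum_agmonWeight_le_sqrt_div_pi_sq hd hρ) hK
  -- Cauchy–Schwarz
  have hCS := Real.inner_le_Lp_mul_Lq_tsum_of_nonneg Real.HolderConjugate.two_two hf0 hg0
    hf2.summable hg2s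
  rw [hf2.tsum_eq] at hCS
  have hsup : ‖v x - v y‖ ≤ ∑' k, f k * g k := by
    simp_rw [hfg]
    exact norm_sub_le_tsum_norm_mFourier_sub_mul hv x y
  have hX0 : 0 ≤ B2 := by rw [hB2]; positivity
  have hY0 : 0 ≤ ∑' k, g k ^ (2 : ℝ) := tsum_nonneg hg2nn
  have hv0 : 0 ≤ ‖v x - v y‖ := norm_nonneg _
  have hsq : ‖v x - v y‖ ^ 2 ≤ B2 * ∑' k, g k ^ (2 : ℝ) := by
    have h1 : ‖v x - v y‖ ≤ B2 ^ (1 / (2 : ℝ)) * (∑' k, g k ^ (2 : ℝ)) ^ (1 / (2 : ℝ)) :=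
      hsup.trans hCS
    have h2 := pow_le_pow_left₀ hv0 h1 2
    refine h2.trans (le_of_eq ?_)
    rw [mul_pow, ← Real.sqrt_eq_rpow, ← Real.sqrt_eq_rpow, Real.sq_sqrt hX0, Real.sq_sqrt hY0]
  exact hsq.trans (mul_le_mul_of_nonneg_left hg2le hX0)

/-! ### The sharp `½`-Hölder estimate -/

/-- The elementary inequality behind the frequency optimisation:
`min(4, a) ≤ 8a/(4 + a)` for `a ≥ 0`, in the form `c ≤ 4 → c ≤ a → c ≤ 8a/(4 + a)`. [folklore] -/
private theorem le_eight_mul_div_four_add {c a : ℝ} (ha : 0 ≤ a) (h4 : c ≤ 4) (hca : c ≤ a) :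
    c ≤ 8 * a / (4 + a) := by
  have hden : 0 < 4 + a := by linarith
  rw [le_div_iff₀ hden]
  rcases le_total a 4 with h | h
  · nlinarith
  · nlinarith

/-- **The sharp Hölder embedding `Ḣ²(T³) ⊂ C^{0,1/2}` with an explicit constant.** For a smooth
real vector field `v` on `T^d`, `card d = 3`, and all `x, y`,
`‖v(x) − v(y)‖² ≤ (4√3/π²) · ‖Δv‖₂² · dist(x, y)` — the periodic form of Bahouri–Chemin–Danchin,
Thm. 1.50 (`s = 2`, `d = 3`, `(k, ρ) = (0, ½)`), with the constant computed from the explicit Agmon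
lattice sum (two choices of the splitting parameter, see the module docstring).
[cite: BahouriCheminDanchinGL343, Thm. 1.50 (book p. 37)] -/
theorem norm_sub_sq_le_laplacian_sq_mul_dist (hd : Fintype.card d = 3)
    {v : UnitAddTorus d → EuclideanSpace ℝ d} (hv : IsSmooth v) (x y : UnitAddTorus d) :
    ‖v x - v y‖ ^ 2 ≤ 4 * Real.sqrt 3 / π ^ 2 * (∫ z, ‖laplacian v z‖ ^ 2) * dist x y := by
  classical
  have hπ : 0 < π := Real.pi_pos
  have h3 : 0 < Real.sqrt 3 := Real.sqrt_pos.2 (by norm_num)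
  have hs3 : Real.sqrt 3 ^ 2 = 3 := Real.sq_sqrt (by norm_num)
  set t : ℝ := dist x y with ht_def
  have ht0 : 0 ≤ t := dist_nonneg
  set B2 : ℝ := ∫ z, ‖laplacian v z‖ ^ 2 with hB2
  have hB0 : 0 ≤ B2 := by rw [hB2]; positivity
  -- the chord bounds in terms of `μₖ = 4π²|k|²` and `t`
  have hchord : ∀ k : d → ℤ, ‖mFourier k x - mFourier k y‖ ^ 2 ≤ 3 * (4 * π ^ 2 * freqNormSq k) * t ^ 2 := by
    intro k
    have h := norm_mFourier_sub_mFourier_sq_le k x y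
    have h3 : (Fintype.card d : ℝ) = 3 := by exact_mod_cast hd
    rw [h3] at h
    exact h
  rcases eq_or_lt_of_le ht0 with ht | ht
  · -- `dist x y = 0`
    have hxy : x = y := dist_eq_zero.1 ht.symm
    have hv0 : v x - v y = 0 := by rw [hxy, sub_self]
    rw [hv0, norm_zero, sq, zero_mul, ← ht, mul_zero]
  have htne : t ≠ 0 := ht.ne'
  -- two regimes for the splitting parameter
  by_cases hsmall : t ≤ 1 / (π * Real.sqrt 3)
  · -- `ρ = 4/(3t²)`, `K = 6t²`
    set ρ : ℝ := 4 / (3 * t ^ 2) with hρ_def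
    have hρ0 : 0 < ρ := by rw [hρ_def]; positivity
    have hρ : 4 * π ^ 2 ≤ ρ := by
      rw [hρ_def, le_div_iff₀ (by positivity)]
      have h1 : t * (π * Real.sqrt 3) ≤ 1 := by
        rwa [le_div_iff₀ (by positivity)] at hsmall
      have h2 : 0 ≤ t * (π * Real.sqrt 3) := by positivity
      nlinarith [hs3, mul_self_le_mul_self h2 h1]
    have hmode : ∀ k : d → ℤ, k ≠ 0 → ‖mFourier k x - mFourier k y‖ ^ 2 ≤
        6 * t ^ 2 * (ρ * (4 * π ^ 2 * freqNormSq k) / (4 * π ^ 2 * freqNormSq k + ρ)) := by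
      intro k hk
      set μ : ℝ := 4 * π ^ 2 * freqNormSq k with hμ
      have hμ0 : 0 < μ := by
        have := one_le_freqNormSq_of_ne_zero hk; rw [hμ]; positivity
      have ha : 0 ≤ 3 * μ * t ^ 2 := by positivity
      have h := le_eight_mul_div_four_add ha (norm_mFourier_sub_mFourier_sq_le_four k x y) (hchord k)
      refine h.trans (le_of_eq ?_)
      have hden1 : (4 : ℝ) + 3 * μ * t ^ 2 ≠ 0 := by positivity
      have hden2 : μ + ρ ≠ 0 := by positivity
      rw [hρ_def] at hden2 ⊢
      field_simp
      ring
    have hmain := norm_sub_sq_le_of_chord_weight_bound hd hv x y hρ (by positivity) hmode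
    refine hmain.trans (le_of_eq ?_)
    have hρsq : ρ = (2 / (Real.sqrt 3 * t)) ^ 2 := by
      rw [hρ_def, div_pow, mul_pow, hs3]; ring
    have hsqrt : Real.sqrt ρ = 2 / (Real.sqrt 3 * t) := by
      rw [hρsq, Real.sqrt_sq (by positivity)]
    rw [hsqrt, show (6 : ℝ) = 2 * Real.sqrt 3 ^ 2 by rw [hs3]; norm_num]
    field_simp
    ring
  · -- `ρ = 4π²`, `K = 2/π²`
    rw [not_le] at hsmall
    have hρ : 4 * π ^ 2 ≤ 4 * π ^ 2 := le_rfl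
    have hmode : ∀ k : d → ℤ, k ≠ 0 → ‖mFourier k x - mFourier k y‖ ^ 2 ≤
        2 / π ^ 2 * (4 * π ^ 2 * (4 * π ^ 2 * freqNormSq k) / (4 * π ^ 2 * freqNormSq k + 4 * π ^ 2)) := by
      intro k hk
      set μ : ℝ := 4 * π ^ 2 * freqNormSq k with hμ
      have hμ1 : 4 * π ^ 2 ≤ μ := by
        have := one_le_freqNormSq_of_ne_zero hk
        rw [hμ]; nlinarith [sq_nonneg π]
      have hμ0 : 0 < μ := lt_of_lt_of_le (by positivity) hμ1
      have h4 := norm_mFourier_sub_mFourier_sq_le_four k x y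
      refine h4.trans ?_
      have hR : 2 / π ^ 2 * (4 * π ^ 2 * μ / (μ + 4 * π ^ 2)) = 8 * μ / (μ + 4 * π ^ 2) := by
        field_simp
        norm_num
      rw [hR, le_div_iff₀ (by positivity)]
      linarith
    have hmain := norm_sub_sq_le_of_chord_weight_bound hd hv x y hρ (by positivity) hmode
    have hsqrt : Real.sqrt (4 * π ^ 2) = 2 * π := by
      rw [show (4 : ℝ) * π ^ 2 = (2 * π) ^ 2 by ring, Real.sqrt_sq (by positivity)]
    rw [hsqrt] at hmain
    -- `B2 · (2/π²) · (2π/π²) = 4 B2/π³ ≤ (4√3/π²) B2 t` since `t ≥ 1/(π√3)`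
    refine hmain.trans ?_
    have hval : 2 / π ^ 2 * (2 * π / π ^ 2) = 4 / π ^ 3 := by field_simp; norm_num
    rw [hval]
    have hkey : 4 / π ^ 3 ≤ 4 * Real.sqrt 3 / π ^ 2 * t := by
      rw [div_le_iff₀ (by positivity)]
      have h1 : 1 < t * (π * Real.sqrt 3) := by
        rwa [div_lt_iff₀ (by positivity)] at hsmall
      calc (4 : ℝ) = 4 * 1 := by ring
        _ ≤ 4 * (t * (π * Real.sqrt 3)) := by nlinarith
        _ = 4 * Real.sqrt 3 / π ^ 2 * t * π ^ 3 := by field_simp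
    calc B2 * (4 / π ^ 3) ≤ B2 * (4 * Real.sqrt 3 / π ^ 2 * t) :=
          mul_le_mul_of_nonneg_left hkey hB0
      _ = 4 * Real.sqrt 3 / π ^ 2 * B2 * t := by ring

/-- **`½`-Hölder modulus, square-root form**: `‖v(x) − v(y)‖ ≤ ‖Δv‖₂ · dist(x,y)^{1/2}` for smooth
`v` on `T³` (the constant `(4√3/π²)^{1/2} ≈ 0.84` of `norm_sub_sq_le_laplacian_sq_mul_dist`
rounded up to `1`). [cite: BahouriCheminDanchinGL343, Thm. 1.50 (book p. 37)] -/
theorem norm_sub_le_sqrt_laplacian_sq_mul_sqrt_dist (hd : Fintype.card d = 3)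
    {v : UnitAddTorus d → EuclideanSpace ℝ d} (hv : IsSmooth v) (x y : UnitAddTorus d) :
    ‖v x - v y‖ ≤ Real.sqrt (∫ z, ‖laplacian v z‖ ^ 2) * dist x y ^ (1 / 2 : ℝ) := by
  have hπ : 0 < π := Real.pi_pos
  set B : ℝ := ∫ z, ‖laplacian v z‖ ^ 2 with hB
  have hB0 : 0 ≤ B := by rw [hB]; positivity
  have ht0 : 0 ≤ dist x y := dist_nonneg
  have hc : 4 * Real.sqrt 3 / π ^ 2 ≤ 1 := by
    rw [div_le_one (by positivity)]
    have h3 : Real.sqrt 3 ≤ 2 := by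
      have h := Real.sqrt_le_sqrt (show (3 : ℝ) ≤ 2 ^ 2 by norm_num)
      rwa [Real.sqrt_sq (by norm_num : (0 : ℝ) ≤ 2)] at h
    have hπ3 : 3 < π := Real.pi_gt_three
    nlinarith
  have h' : ‖v x - v y‖ ^ 2 ≤ B * dist x y := by
    calc ‖v x - v y‖ ^ 2 ≤ 4 * Real.sqrt 3 / π ^ 2 * B * dist x y :=
          norm_sub_sq_le_laplacian_sq_mul_dist hd hv x y
      _ ≤ 1 * B * dist x y := by gcongr
      _ = B * dist x y := by rw [one_mul]
  calc ‖v x - v y‖ = Real.sqrt (‖v x - v y‖ ^ 2) := (Real.sqrt_sq (norm_nonneg _)).symm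
    _ ≤ Real.sqrt (B * dist x y) := Real.sqrt_le_sqrt h'
    _ = Real.sqrt B * dist x y ^ (1 / 2 : ℝ) := by
        rw [Real.sqrt_mul hB0, Real.sqrt_eq_rpow (dist x y)]

/-- **`HolderWith` form on `T³`**: a smooth `v : T³ → ℝ³` is `½`-Hölder with constant `‖Δv‖₂`.
[cite: BahouriCheminDanchinGL343, Thm. 1.50 (book p. 37)] -/
theorem holderWith_half_sqrt_laplacian_sq (hd : Fintype.card d = 3)
    {v : UnitAddTorus d → EuclideanSpace ℝ d} (hv : IsSmooth v) :
    HolderWith (Real.sqrt (∫ z, ‖laplacian v z‖ ^ 2)).toNNReal (1 / 2) v := by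
  refine FunctionSpaces.holderWith_of_dist_le fun x y => ?_
  rw [dist_eq_norm, Real.coe_toNNReal _ (Real.sqrt_nonneg _)]
  have h := norm_sub_le_sqrt_laplacian_sq_mul_sqrt_dist hd hv x y
  convert h using 2
  norm_num

/-- **`HolderWith` form for the periodic lift**: for smooth `v : T³ → ℝ³` the `ℤ³`-periodic field
`v ∘ proj : ℝ³ → ℝ³` is `½`-Hölder with constant `‖Δv‖_{L²(T³)}` (the projection `ℝ³ → T³` is
`1`-Lipschitz, `Torus.HolderWith.lift`). [cite: BahouriCheminDanchinGL343, Thm. 1.50 (book p. 37)] -/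
theorem holderWith_half_lift_sqrt_laplacian_sq (hd : Fintype.card d = 3)
    {v : UnitAddTorus d → EuclideanSpace ℝ d} (hv : IsSmooth v) :
    HolderWith (Real.sqrt (∫ z, ‖laplacian v z‖ ^ 2)).toNNReal (1 / 2) (lift v) :=
  HolderWith.lift (holderWith_half_sqrt_laplacian_sq hd hv)

end Torus

end Literature.Analysis.FunctionSpaces

end
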